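import Mathlib
import HarnessLib
import HarnessLib.Audit
import Summits.ValiantsHypothesis.ValiantsHypothesis.Theorems.LacunarySymmetroidMatrixDescartesProductPlusOneEulerSharpK
import Summits.ValiantsHypothesis.ValiantsHypothesis.Theorems.LacunarySymmetroidMatrixDescartesSmallRatio
import Literature.Analysis.FluidPDE.ElgindiRadialCoefficients

/-!
# ValiantsHypothesis / LacunarySymmetroid — crux `MatrixDescartes` (stmt-ValiantsHypothesis-18050, V1), LINE (A) «product_plus_one»:
# DICTIONARY between the floor's Euler count and the `ZeroChange` cells (pen val-idea-25 g9 NOTE §56.1, kernel), and THEOREM D in floor currency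

The floor `OneChangeFloorK3` counts the positive roots of `eulerNumerator d a 0` (unfolded:
`Σ_j (Σ_l C(a_{jl}(d_l − d_0)) X^{d_l})·∏_{i≠j} f_i`, `f_i = Σ_l C a_{il} X^{d_l}`), while the `ZeroChange` cells (✓ `…ZeroChangeRows`,
`…BinomialLead`, `…MonomialRow`, `…MiddleBinomial`, `…TopBinomial`, `…ConstantFreeRow`, `…SmallRatio`) count `posCrit (∏_j row a c …)`, the
positive critical points of the product of the normalised rows `row (d₁−d₀) (d₂−d₀) a_{j0} a_{j1} a_{j2}`.  NOTE §56.1 says these are the same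
number; here it is in the kernel:

* `euler_bottom_eq_X_pow_mul_derivative` — `eulerNumerator d a 0 = X^{m·d₀+1} · (∏_j row …)′` (from ✓ `eulerNumerator_eq_general` and the tree's `Elgindi.X_mul_derivative_X_pow`:
  `E = X·P′ − C(m d₀)·P` with `P = X^{m d₀}·∏ row`);
* ★ `card_posRoots_euler_bottom_eq_posCrit` — `Z₊(eulerNumerator d a 0) = posCrit (∏_j row (d₁−d₀) (d₂−d₀) a_{j0} a_{j1} a_{j2})` for
  `d₀ ≤ d₁`, `d₀ ≤ d₂`;
* ★ `floor_smallRatio_le_two` — THEOREM D in floor currency: `d₀ < d₁ < d₂`, `d₂ − d₀ ≤ 2(d₁ − d₀)`, row `0` of sign type `(−,+,+)`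
  (`a₀₀ < 0 ≤ a₀₁`, `0 < a₀₂`; a `(+,−,−)` = T5 row up to the sign of the row) and all other rows one-signed nonnegative with positive bottom letter
  ⇒ `Z₊(eulerNumerator d a 0) ≤ 2`, for every `m` (✓ `ZeroChange.smallRatioAtMostTwo`).

HONEST FRAMING: bookkeeping + one floor-currency cell; closes NO stub (`OneChangeFloorK3` quantifies over all one-change companies and all ratios);
`MatrixDescartes` OPEN; `VP ≠ VNP` is NOT proved and nothing here bears on it.  No definitions, no named facts, no sorry.
-/

set_option linter.dupNamespace false

namespace Summit.ValiantsHypothesis.ValiantsHypothesis.Theorems.LacunarySymmetroidMatrixDescartes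

namespace ZeroChange

open Polynomial Finset

/-- A three-letter row on the support `d` (with `d₀ ≤ d₁, d₂`) is `X^{d₀}` times the normalised row. -/
theorem fewnomial_three_eq_X_pow_mul_row (d : Fin 3 → ℕ) (h01 : d 0 ≤ d 1) (h02 : d 0 ≤ d 2) (b : Fin 3 → ℝ) :
    (∑ l, C (b l) * X ^ (d l) : ℝ[X]) = X ^ (d 0) * row (d 1 - d 0) (d 2 - d 0) (b 0) (b 1) (b 2) := by
  rw [Fin.sum_univ_three, row]
  have h1 : (X : ℝ[X]) ^ (d 1) = X ^ (d 0) * X ^ (d 1 - d 0) := by rw [← pow_add, Nat.add_sub_cancel' h01]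
  have h2 : (X : ℝ[X]) ^ (d 2) = X ^ (d 0) * X ^ (d 2 - d 0) := by rw [← pow_add, Nat.add_sub_cancel' h02]
  rw [h1, h2]
  ring

/-- **`eulerNumerator d a 0 = X^{m d₀ + 1} · (∏ row)′`** (unfolded Euler numerator at the bottom coupling). -/
theorem euler_bottom_eq_X_pow_mul_derivative {m : ℕ} (d : Fin 3 → ℕ) (h01 : d 0 ≤ d 1) (h02 : d 0 ≤ d 2)
    (a : Fin m → Fin 3 → ℝ) :
    (∑ j, (∑ l, C (a j l * ((d l : ℝ) - d 0)) * X ^ (d l)) * ∏ i ∈ Finset.univ.erase j, (∑ l, C (a i l) * X ^ (d l)) : ℝ[X])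
      = X ^ (m * d 0 + 1) * derivative (∏ j, row (d 1 - d 0) (d 2 - d 0) (a j 0) (a j 1) (a j 2)) := by
  rw [ProductPlusOne.eulerNumerator_eq_general]
  have hP : (∏ j, ∑ l, C (a j l) * X ^ (d l) : ℝ[X]) = X ^ (m * d 0) * ∏ j, row (d 1 - d 0) (d 2 - d 0) (a j 0) (a j 1) (a j 2) := by
    rw [Finset.prod_congr rfl fun j _ => fewnomial_three_eq_X_pow_mul_row d h01 h02 (a j), Finset.prod_mul_distrib,
      Finset.prod_const, Finset.card_univ, Fintype.card_fin, ← pow_mul, mul_comm (d 0) m]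
  rw [hP, derivative_mul, mul_add, ← mul_assoc, ← mul_assoc, Literature.Analysis.FluidPDE.Elgindi.X_mul_derivative_X_pow]
  have hc : C ((m : ℝ) * ((d 0 : ℕ) : ℝ)) = C (((m * d 0 : ℕ) : ℝ)) := by push_cast; ring_nf
  rw [hc, pow_succ]
  ring

/-- ★ **DICTIONARY (NOTE §56.1, kernel): the floor's Euler count at the bottom coupling IS the `ZeroChange` count** —
`Z₊(eulerNumerator d a 0) = posCrit (∏_j row (d₁−d₀) (d₂−d₀) a_{j0} a_{j1} a_{j2})` whenever `d₀ ≤ d₁` and `d₀ ≤ d₂`. -/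
theorem card_posRoots_euler_bottom_eq_posCrit {m : ℕ} (d : Fin 3 → ℕ) (h01 : d 0 ≤ d 1) (h02 : d 0 ≤ d 2)
    (a : Fin m → Fin 3 → ℝ) :
    ((∑ j, (∑ l, C (a j l * ((d l : ℝ) - d 0)) * X ^ (d l)) * ∏ i ∈ Finset.univ.erase j, (∑ l, C (a i l) * X ^ (d l))
        : ℝ[X]).roots.toFinset.filter (fun t => 0 < t)).card
      = posCrit (∏ j, row (d 1 - d 0) (d 2 - d 0) (a j 0) (a j 1) (a j 2)) := by
  classical
  rw [euler_bottom_eq_X_pow_mul_derivative d h01 h02 a, posCrit]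
  set D := derivative (∏ j, row (d 1 - d 0) (d 2 - d 0) (a j 0) (a j 1) (a j 2)) with hD
  by_cases hD0 : D = 0
  · simp [hD0]
  congr 1
  ext t
  simp only [Finset.mem_filter, Multiset.mem_toFinset]
  rw [mem_roots (mul_ne_zero (pow_ne_zero _ X_ne_zero) hD0), mem_roots hD0, IsRoot.def, IsRoot.def, eval_mul, eval_pow,
    eval_X, mul_eq_zero]
  constructor
  · rintro ⟨h | h, ht⟩
    · exact absurd ((pow_eq_zero_iff (by omega : m * d 0 + 1 ≠ 0)).1 h) ht.ne'
    · exact ⟨h, ht⟩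
  · rintro ⟨h, ht⟩
    exact ⟨Or.inr h, ht⟩

/-- ★ **THEOREM D IN FLOOR CURRENCY** (✓ `ZeroChange.smallRatioAtMostTwo` through the dictionary): on a support `d₀ < d₁ < d₂` with
`d₂ − d₀ ≤ 2(d₁ − d₀)`, a company whose row `0` has sign type `(−, +, +)` (`a₀₀ < 0`, `a₀₁ ≥ 0`, `a₀₂ > 0`) and whose other rows are
nonnegative with positive bottom letter has `Z₊(eulerNumerator d a 0) ≤ 2`, for every `m`. -/
theorem floor_smallRatio_le_two {m : ℕ} (d : Fin 3 → ℕ) (h01 : d 0 < d 1) (h12 : d 1 < d 2)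
    (hratio : d 2 - d 0 ≤ 2 * (d 1 - d 0)) (a : Fin (m + 1) → Fin 3 → ℝ)
    (hW : a 0 0 < 0 ∧ 0 ≤ a 0 1 ∧ 0 < a 0 2) (hB : ∀ i : Fin m, 0 < a i.succ 0 ∧ 0 ≤ a i.succ 1 ∧ 0 ≤ a i.succ 2) :
    ((∑ j, (∑ l, C (a j l * ((d l : ℝ) - d 0)) * X ^ (d l)) * ∏ i ∈ Finset.univ.erase j, (∑ l, C (a i l) * X ^ (d l))
        : ℝ[X]).roots.toFinset.filter (fun t => 0 < t)).card ≤ 2 := by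
  rw [card_posRoots_euler_bottom_eq_posCrit d h01.le (h01.le.trans h12.le) a, Fin.prod_univ_succ]
  have hneg : row (d 1 - d 0) (d 2 - d 0) (a 0 0) (a 0 1) (a 0 2) = row (d 1 - d 0) (d 2 - d 0) (-(-a 0 0)) (a 0 1) (a 0 2) := by
    rw [neg_neg]
  rw [hneg]
  exact smallRatioAtMostTwo m (d 1 - d 0) (d 2 - d 0) (by omega) (by omega) (by omega) (-a 0 0) (a 0 1) (a 0 2)
    (fun i => a i.succ 0) (fun i => a i.succ 1) (fun i => a i.succ 2) (by linarith [hW.1]) hW.2.1 hW.2.2 hB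

end ZeroChange

end Summit.ValiantsHypothesis.ValiantsHypothesis.Theorems.LacunarySymmetroidMatrixDescartes
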